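import Literature.NumberTheory.Rogawski1990.ArchCentralLimitFunctionalNoncompactWall   -- ★ p843019 (this seat): the one-sided corner transfer whose premise (h1) this file discharges
import Mathlib.Analysis.SpecialFunctions.Trigonometric.Deriv
import HarnessLib

/-!
# (J3-odd), ORDER ONE: the first wall-normal derivatives of the two corner extensions of `F_Θ = ρ′Δ·Φ_Θ` AGREE on a half of the noncompact wall `θ₀ = θ₂` — from
# Harish-Chandra's limit formula at the wall, descended form (the letter (J-nc) ★ `ArchLimitFormulaNoncompactWall`, PROVED in the tree) (Rogawski 1990 §8.2 p. 119, §8.4 p. 126)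

Topic `NumberTheory/Rogawski1990`; namespace `Literature.NumberTheory.Rogawski1990`.  THEOREMS ONLY (no `def`, no instance, no notation, no axiom, no named fact, no `sorry`).
Cell `pub/hodgecm-mathlib`, ENGINE T1 (crux H413 = `stmt-HodgeConjecture-24833`); ROAD A toward the letter N1 `ArchCentralLimitFormulaRankTwo` (★ p842205), LEAD F0P3a-plan (g10)
WORD T9-8 (D) «(A5) opened», ROAD A owner F0P3a-p05 (g13) 08:54Z «N1 ⇝ {(A4) value, (A6) corner regularity, (J3-odd)}»; author A-p18 (g25), 2026-09-01.

WHAT IS PROVED.  The one-sided corner transfer ★ `lambda8Angle_zero_eq_of_wall02_oddJets_of_isOpen` (p843019) asks, for the two `C³` corner extensions `H, H′` of `F_Θ∘chart` from the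
chambers adjacent across a half-wall `{t•A′ : t ∈ S}` of `θ₀ = θ₂` (`A′ = (1,−2,1)`, normal `N′ = (1,0,−1)`), that their FIRST (premise (h1)) and THIRD (premise (h3)) `N′`-derivatives agree at
the wall points.  THIS FILE DISCHARGES (h1) from the (J-nc) limit formula, for ANY torus function `Fz : (S¹)³ → ℂ` in place of the orbital integral `z ↦ ∫ Θ(g·t(z)·g⁻¹) dν`:
* §1 chamber geometry of the normal line: for `t > 0`, `tA′ + sN′ ∈ {θ₁<θ₂<θ₀}` (`0 < s < 3t`) and `∈ {θ₁<θ₀<θ₂}` (`−3t < s < 0`); for `t < 0`, `∈ {θ₂<θ₀<θ₁}` (`0 < s < −3t`) and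
  `∈ {θ₀<θ₂<θ₁}` (`3t < s < 0`) — which chamber agreement feeds which side;
* §2 `rhoWeylDelta_angleChart_wall02_line` — ALONG THE NORMAL LINE THE LETTER'S DENSITY FACTORS EXACTLY: `ρ′Δ(ζe^{i(tA′+sN′)}) = 2 sin s · i(2cos s − 2cos 3t)`; the cofactor
  `r(s) = i(2cos s − 2cos 3t)` of print's `g(ψ) = 2 sin ψ · Φ` is EVEN in `s` (`r′(0) = 0`: the two other root factors `e₀−e₁`, `e₁−e₂` are exchanged by the wall reflection) and
  `r(0) = 2i(1 − cos 3t) ≠ 0` at a semiregular wall point; and `angleChart_wall02_line_eq_curve` — the chart of the normal line IS the (J-nc) one-angle curve through `ζe^{itA′}`;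
* §3 `deriv_eq_mul_of_eventuallyEq_mul_of_tendsto_deriv` — ONE-VARIABLE CORE: if `h` is `C¹` near `0`, `h = r·g` on one side `T` of `0` (`T` open, `0 ∈ closure T`), `r` differentiable with
  `r′ → 0` at `0` and `r(0) ≠ 0`, and `deriv g → L` within `T`, then `h′(0) = r(0)·L` (quotient rule on `T` + uniqueness of one-sided limits);
* §4 **`deriv_cornerExtensions_eq_of_wall02_limitFormula`** — for `H, H′` of class `C¹` on an open `U ∋ 0` that agree with `ρ′Δ·Fz∘chart` on the two sides of the normal lines through the
  wall points `tA′`, `t ∈ S` (`cos 3t ≠ 1`), and the (J-nc)-SHAPED premise «`∂_ψ[2 sin ψ · Fz(z₀·(e^{iψ}, 1, e^{−iψ}))]` has a two-sided limit at `ψ = 0`» at `z₀ = ζe^{itA′}` — VERBATIM the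
  conclusion of ★ `ArchLimitFormulaNoncompactWall` at that wall point, so the assembly discharges it by ★ `archLimitFormulaNoncompactWall_holds` with its own `νH` —:
  `∀ t ∈ S, (d∕ds)|₀ H(tA′+sN′) = (d∕ds)|₀ H′(tA′+sN′)` = premise (h1).  No jump relation for `F_Θ` itself is used: `F_Θ` DOES jump across the wall (order `0`), but `ω` never reads it.
The ORDER-THREE premise (h3) is NOT reachable from (J-nc) (it needs `(d∕dθ)^{2r}ψ_g = ψ_{□^r g}` [Varadarajan1989 §6.4 Thm 17] after descent) and stays the booked print row (J3-odd), now halved.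
HONEST LABEL: bookkeeping of ROAD A; proves nothing about HC_CM, which is proved only modulo the printed citations until rung 0 closes.

## References
* [Rogawski1990] J. D. Rogawski, *Automorphic Representations of Unitary Groups in Three Variables*, Ann. of Math. Stud. 123 (1990), §8.2 p. 119 («`lim_{ψ→0} ∂∕∂ψ g(ψ) = c f^H(γ₀)`»),
  §8.4 pp. 126–127.
* [Varadarajan1989] V. S. Varadarajan, *An Introduction to Harmonic Analysis on Semisimple Lie Groups* (1989), §6.4 Thm 22 (order one: `F′_{f,B}` continuous at `θ = 0`), Thm 23
  (order zero jumps), Thm 17 (`(d∕dθ)^{2r}ψ_g = ψ_{□^r g}`, the order-three mechanism) pp. 204–210 (held e-text, read).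
-/

set_option autoImplicit false

noncomputable section

open Filter Topology Set Complex

namespace Literature.NumberTheory.Rogawski1990

/-! ## §1 Chamber geometry of the normal line through a wall point `tA′` -/

section Geometry

/-- The angle coordinates of the normal line through the wall point `tA′`: `(tA′ + sN′) = (t + s, −2t, t − s)`. [cite: Rogawski1990, §8.4 p. 126] -/
theorem wall02_line_apply (t s : ℝ) :
    (t • (![1, -2, 1] : Fin 3 → ℝ) + s • (![1, 0, -1] : Fin 3 → ℝ)) 0 = t + s ∧
      (t • (![1, -2, 1] : Fin 3 → ℝ) + s • (![1, 0, -1] : Fin 3 → ℝ)) 1 = -(2 * t) ∧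
      (t • (![1, -2, 1] : Fin 3 → ℝ) + s • (![1, 0, -1] : Fin 3 → ℝ)) 2 = t - s := by
  refine ⟨by simp, by simp; ring, by simp; ring⟩

/-- `0 < s < 3t` (so `t > 0`): the point `tA′ + sN′` lies in the doubly-noncompact chamber `{θ₁ < θ₂ < θ₀}` (label `[1,2,0]`, `S⁻`). [cite: Rogawski1990, §8.4 p. 126] -/
theorem wall02_line_mem_chamber_pos_pos {t s : ℝ} (hs : 0 < s) (hs' : s < 3 * t) :
    (t • (![1, -2, 1] : Fin 3 → ℝ) + s • (![1, 0, -1] : Fin 3 → ℝ)) 1 < (t • (![1, -2, 1] : Fin 3 → ℝ) + s • (![1, 0, -1] : Fin 3 → ℝ)) 2 ∧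
      (t • (![1, -2, 1] : Fin 3 → ℝ) + s • (![1, 0, -1] : Fin 3 → ℝ)) 2 < (t • (![1, -2, 1] : Fin 3 → ℝ) + s • (![1, 0, -1] : Fin 3 → ℝ)) 0 := by
  obtain ⟨h0, h1, h2⟩ := wall02_line_apply t s
  rw [h0, h1, h2]
  constructor <;> linarith

/-- `−3t < s < 0` (so `t > 0`): the point `tA′ + sN′` lies in the compact-adjacent chamber `{θ₁ < θ₀ < θ₂}` (label `[1,0,2]`, in `D⁺`). [cite: Rogawski1990, §8.4 p. 126] -/
theorem wall02_line_mem_chamber_pos_neg {t s : ℝ} (hs : s < 0) (hs' : -(3 * t) < s) :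
    (t • (![1, -2, 1] : Fin 3 → ℝ) + s • (![1, 0, -1] : Fin 3 → ℝ)) 1 < (t • (![1, -2, 1] : Fin 3 → ℝ) + s • (![1, 0, -1] : Fin 3 → ℝ)) 0 ∧
      (t • (![1, -2, 1] : Fin 3 → ℝ) + s • (![1, 0, -1] : Fin 3 → ℝ)) 0 < (t • (![1, -2, 1] : Fin 3 → ℝ) + s • (![1, 0, -1] : Fin 3 → ℝ)) 2 := by
  obtain ⟨h0, h1, h2⟩ := wall02_line_apply t s
  rw [h0, h1, h2]
  constructor <;> linarith

/-- `0 < s < −3t` (so `t < 0`): the point `tA′ + sN′` lies in the compact-adjacent chamber `{θ₂ < θ₀ < θ₁}` (label `[2,0,1]`, in `D⁻`). [cite: Rogawski1990, §8.4 p. 126] -/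
theorem wall02_line_mem_chamber_neg_pos {t s : ℝ} (hs : 0 < s) (hs' : s < -(3 * t)) :
    (t • (![1, -2, 1] : Fin 3 → ℝ) + s • (![1, 0, -1] : Fin 3 → ℝ)) 2 < (t • (![1, -2, 1] : Fin 3 → ℝ) + s • (![1, 0, -1] : Fin 3 → ℝ)) 0 ∧
      (t • (![1, -2, 1] : Fin 3 → ℝ) + s • (![1, 0, -1] : Fin 3 → ℝ)) 0 < (t • (![1, -2, 1] : Fin 3 → ℝ) + s • (![1, 0, -1] : Fin 3 → ℝ)) 1 := by
  obtain ⟨h0, h1, h2⟩ := wall02_line_apply t s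
  rw [h0, h1, h2]
  constructor <;> linarith

/-- `3t < s < 0` (so `t < 0`): the point `tA′ + sN′` lies in the doubly-noncompact chamber `{θ₀ < θ₂ < θ₁}` (label `[0,2,1]`, `S⁺`). [cite: Rogawski1990, §8.4 p. 126] -/
theorem wall02_line_mem_chamber_neg_neg {t s : ℝ} (hs : s < 0) (hs' : 3 * t < s) :
    (t • (![1, -2, 1] : Fin 3 → ℝ) + s • (![1, 0, -1] : Fin 3 → ℝ)) 0 < (t • (![1, -2, 1] : Fin 3 → ℝ) + s • (![1, 0, -1] : Fin 3 → ℝ)) 2 ∧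
      (t • (![1, -2, 1] : Fin 3 → ℝ) + s • (![1, 0, -1] : Fin 3 → ℝ)) 2 < (t • (![1, -2, 1] : Fin 3 → ℝ) + s • (![1, 0, -1] : Fin 3 → ℝ)) 1 := by
  obtain ⟨h0, h1, h2⟩ := wall02_line_apply t s
  rw [h0, h1, h2]
  constructor <;> linarith

end Geometry

/-! ## §2 The letter's density along the normal line, and the (J-nc) curve -/

section Density

/-- **ALONG THE NORMAL LINE THE LETTER'S DENSITY FACTORS EXACTLY**: `ρ′Δ(ζe^{i(tA′+sN′)}) = 2 sin s · i(2cos s − 2cos 3t)` — the root `e₀ − e₂` gives print's `2 sin ψ`, the two roots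
exchanged by the wall reflection give the EVEN cofactor `2cos s − 2cos 3t`.  (`ρ′Δ` in the letter's inline token at the chart point `ζe^{iθ}`, `θ = tA′ + sN′`.)
[cite: Rogawski1990, §8.4 p. 126] [cite: Rogawski1990, §8.2 p. 119] -/
theorem rhoWeylDelta_angleChart_wall02_line (ζ : Circle) (t s : ℝ) :
    ((((ζ * Circle.exp ((t • (![1, -2, 1] : Fin 3 → ℝ) + s • (![1, 0, -1] : Fin 3 → ℝ)) 0) : Circle) : ℂ)) *
          (((ζ * Circle.exp ((t • (![1, -2, 1] : Fin 3 → ℝ) + s • (![1, 0, -1] : Fin 3 → ℝ)) 2) : Circle) : ℂ))⁻¹) *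
        ((1 - (((ζ * Circle.exp ((t • (![1, -2, 1] : Fin 3 → ℝ) + s • (![1, 0, -1] : Fin 3 → ℝ)) 1) : Circle) : ℂ)) *
              (((ζ * Circle.exp ((t • (![1, -2, 1] : Fin 3 → ℝ) + s • (![1, 0, -1] : Fin 3 → ℝ)) 0) : Circle) : ℂ))⁻¹) *
          (1 - (((ζ * Circle.exp ((t • (![1, -2, 1] : Fin 3 → ℝ) + s • (![1, 0, -1] : Fin 3 → ℝ)) 2) : Circle) : ℂ)) *
              (((ζ * Circle.exp ((t • (![1, -2, 1] : Fin 3 → ℝ) + s • (![1, 0, -1] : Fin 3 → ℝ)) 1) : Circle) : ℂ))⁻¹) *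
          (1 - (((ζ * Circle.exp ((t • (![1, -2, 1] : Fin 3 → ℝ) + s • (![1, 0, -1] : Fin 3 → ℝ)) 2) : Circle) : ℂ)) *
              (((ζ * Circle.exp ((t • (![1, -2, 1] : Fin 3 → ℝ) + s • (![1, 0, -1] : Fin 3 → ℝ)) 0) : Circle) : ℂ))⁻¹)) =
      (2 * Real.sin s : ℂ) * (Complex.I * (2 * Real.cos s - 2 * Real.cos (3 * t) : ℂ)) := by
  obtain ⟨h0, h1, h2⟩ := wall02_line_apply t s
  rw [h0, h1, h2]
  have c0 : (((ζ * Circle.exp (t + s) : Circle) : ℂ)) = (ζ : ℂ) * (Complex.exp (t * I) * Complex.exp (s * I)) := by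
    rw [Circle.coe_mul, Circle.coe_exp, ← Complex.exp_add]; push_cast; ring_nf
  have c1 : (((ζ * Circle.exp (-(2 * t)) : Circle) : ℂ)) = (ζ : ℂ) * (Complex.exp (t * I) ^ 2)⁻¹ := by
    rw [Circle.coe_mul, Circle.coe_exp, ← Complex.exp_nat_mul, ← Complex.exp_neg]; push_cast; ring_nf
  have c2 : (((ζ * Circle.exp (t - s) : Circle) : ℂ)) = (ζ : ℂ) * (Complex.exp (t * I) * (Complex.exp (s * I))⁻¹) := by
    rw [Circle.coe_mul, Circle.coe_exp, ← Complex.exp_neg, ← Complex.exp_add]; push_cast; ring_nf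
  have hs : ((Real.sin s : ℝ) : ℂ) = ((Complex.exp (s * I))⁻¹ - Complex.exp (s * I)) * I / 2 := by
    rw [Complex.ofReal_sin, Complex.sin, ← Complex.exp_neg]; ring_nf
  have hc : ((Real.cos s : ℝ) : ℂ) = (Complex.exp (s * I) + (Complex.exp (s * I))⁻¹) / 2 := by
    rw [Complex.ofReal_cos, Complex.cos, ← Complex.exp_neg]; ring_nf
  have hc3 : ((Real.cos (3 * t) : ℝ) : ℂ) = (Complex.exp (t * I) ^ 3 + (Complex.exp (t * I) ^ 3)⁻¹) / 2 := by
    rw [Complex.ofReal_cos, Complex.cos, ← Complex.exp_nat_mul, ← Complex.exp_neg]; push_cast; ring_nf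
  rw [c0, c1, c2, hs, hc, hc3]
  have hζ : (ζ : ℂ) ≠ 0 := Circle.coe_ne_zero ζ
  have ha : Complex.exp (s * I) ≠ 0 := Complex.exp_ne_zero _
  have hb : Complex.exp (t * I) ≠ 0 := Complex.exp_ne_zero _
  field_simp
  ring_nf
  rw [Complex.I_sq]
  ring

/-- **The chart of the normal line is the (J-nc) one-angle curve through the wall point**: `ζe^{i(tA′+sN′)_k} = (ζe^{i(tA′)_k})·e^{i(1,0,−1)_k s}`. [cite: Rogawski1990, §8.2 p. 119] -/
theorem angleChart_wall02_line_eq_curve (ζ : Circle) (t s : ℝ) :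
    (fun k : Fin 3 => ζ * Circle.exp ((t • (![1, -2, 1] : Fin 3 → ℝ) + s • (![1, 0, -1] : Fin 3 → ℝ)) k)) =
      fun i : Fin 3 => ζ * Circle.exp ((t • (![1, -2, 1] : Fin 3 → ℝ)) i) * Circle.exp ((![(1 : ℝ), 0, -1] : Fin 3 → ℝ) i * s) := by
  funext i
  simp only [mul_assoc, ← Circle.exp_add]
  congr 2
  fin_cases i <;> simp [mul_comm]

end Density

/-! ## §3 The one-variable core: `h = r·g` on one side, `h ∈ C¹`, `r′ → 0`, `deriv g → L` ⟹ `h′(0) = r(0)·L` -/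

section Core

/-- **ONE-VARIABLE CORE.**  Let `T ⊆ ℝ` be open with `𝓝[T] 0` nontrivial (a side of `0`), `h` of class `C¹` on an open `V ∋ 0`, `r` differentiable with derivative `r′ → 0` at `0` and `r(0) ≠ 0`,
and `h = r·g` on `T` near `0`.  If `deriv g → L` along `𝓝[T] 0` then `h′(0) = r(0)·L`: on `T` near `0`, `g = h∕r`, so `deriv g = (h′r − h r′)∕r² → h′(0)∕r(0)`.
(Print: `g(ψ) = 2 sin ψ · Φ_H`, `lim ∂g∕∂ψ = c f^H(γ₀)`.) [cite: Rogawski1990, §8.2 p. 119] [cite: Varadarajan1989, §6.4 Thm 22] -/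
theorem deriv_eq_mul_of_eventuallyEq_mul_of_tendsto_deriv {T : Set ℝ} (hT : IsOpen T) [hT0 : (𝓝[T] (0 : ℝ)).NeBot]
    {h r g : ℝ → ℂ} {r' : ℝ → ℂ} {V : Set ℝ} (hV : IsOpen V) (h0V : (0 : ℝ) ∈ V) (hh : ContDiffOn ℝ 1 h V)
    (hr : ∀ s, HasDerivAt r (r' s) s) (hr'0 : Tendsto r' (𝓝 0) (𝓝 0)) (hr0 : r 0 ≠ 0)
    (heq : ∀ᶠ s in 𝓝[T] 0, h s = r s * g s) {L : ℂ} (hg : Tendsto (fun s => deriv g s) (𝓝[T] 0) (𝓝 L)) :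
    deriv h 0 = r 0 * L := by
  have hrc : Continuous r := continuous_iff_continuousAt.2 fun s => (hr s).continuousAt
  -- the open set `O` on which the quotient rule is available
  obtain ⟨W, ⟨hW0, hWo⟩, hW⟩ := (nhdsWithin_basis_open (0 : ℝ) T).eventually_iff.1 heq
  set O : Set ℝ := W ∩ V ∩ {s | r s ≠ 0} with hO
  have hOo : IsOpen O := (hWo.inter hV).inter (isOpen_ne_fun hrc continuous_const)
  have hO0 : (0 : ℝ) ∈ O := ⟨⟨hW0, h0V⟩, hr0⟩
  have hdiff : DifferentiableOn ℝ h V := hh.differentiableOn (by norm_num)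
  have hderiv : ∀ s ∈ O ∩ T, deriv g s = (deriv h s * r s - h s * r' s) / (r s) ^ 2 := by
    rintro s ⟨⟨⟨hsW, hsV⟩, hsr⟩, hsT⟩
    have hloc : g =ᶠ[𝓝 s] fun x => h x / r x := by
      filter_upwards [(hOo.inter hT).mem_nhds ⟨⟨⟨hsW, hsV⟩, hsr⟩, hsT⟩] with x hx
      have hx' : h x = r x * g x := hW ⟨hx.1.1.1, hx.2⟩
      have hrx : r x ≠ 0 := hx.1.2
      field_simp
      rw [hx']; ring
    rw [hloc.deriv_eq]
    have hhd : HasDerivAt h (deriv h s) s := ((hdiff s hsV).differentiableAt (hV.mem_nhds hsV)).hasDerivAt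
    exact ((hhd.div (hr s) hsr).deriv)
  -- the quotient-rule expression tends to `h′(0)/r(0)` along `𝓝[T] 0`
  have hdh : ContinuousAt (deriv h) 0 := (hh.continuousOn_deriv_of_isOpen hV le_rfl).continuousAt (hV.mem_nhds h0V)
  have hhc : ContinuousAt h 0 := (hh.continuousOn.continuousAt (hV.mem_nhds h0V))
  have hlim : Tendsto (fun s => (deriv h s * r s - h s * r' s) / (r s) ^ 2) (𝓝[T] 0) (𝓝 ((deriv h 0 * r 0 - h 0 * 0) / (r 0) ^ 2)) := by
    refine Tendsto.mono_left ?_ nhdsWithin_le_nhds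
    exact ((hdh.tendsto.mul (hrc.continuousAt.tendsto)).sub (hhc.tendsto.mul hr'0)).div ((hrc.continuousAt.tendsto).pow 2) (pow_ne_zero 2 hr0)
  have hcongr : (fun s => deriv g s) =ᶠ[𝓝[T] 0] fun s => (deriv h s * r s - h s * r' s) / (r s) ^ 2 := by
    filter_upwards [inter_mem (mem_nhdsWithin_of_mem_nhds (hOo.mem_nhds hO0)) self_mem_nhdsWithin] with s hs
    exact hderiv s hs
  have hL : L = (deriv h 0 * r 0 - h 0 * 0) / (r 0) ^ 2 := tendsto_nhds_unique hg (hlim.congr' hcongr.symm)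
  rw [hL]
  field_simp
  ring

end Core

/-! ## §4 The first wall-normal derivatives of the two corner extensions agree on the half-wall -/

section FirstJet

/-- **(J3-odd), ORDER ONE, FROM THE (J-nc) LIMIT FORMULA.**  Let `Fz : (S¹)³ → ℂ` be any torus function (the orbital integral `z ↦ ∫ Θ(g·t(z)·g⁻¹) dν` of the letter), `ζ ∈ S¹`, and
`H, H′` of class `C¹` on an open set `U` of angles — the corner extensions of `F_Θ∘chart = ρ′Δ·Fz∘chart` from the two chambers adjacent across a half-wall of `θ₀ = θ₂`.  Let `S` be a
set of wall parameters with `tA′ ∈ U` and `cos 3t ≠ 1` (the wall point `ζe^{itA′} = (ζe^{it}, ζe^{−2it}, ζe^{it})` is SEMIREGULAR) for `t ∈ S`, such that along the normal line through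
`tA′`: `H = ρ′Δ·Fz∘chart` for small `s > 0` and `H′ = ρ′Δ·Fz∘chart` for small `s < 0` (§1 tells which chamber agreement gives which), and such that AT EACH SUCH WALL POINT THE
(J-nc) LIMIT FORMULA HOLDS in the shape of ★ `ArchLimitFormulaNoncompactWall`: `∂_ψ[2 sin ψ · Fz(z₀·(e^{iψ}, 1, e^{−iψ}))]` has a two-sided limit as `ψ → 0`, `ψ ≠ 0`
(print: «`lim_{ψ→0} ∂∕∂ψ g(ψ) = c f^H(γ₀)`»; in the tree `archLimitFormulaNoncompactWall_holds`, whose `z₀ 0 = z₀ 2`, `z₀ 0 ≠ z₀ 1` are `rfl` and `cos 3t ≠ 1` here).  THEN the first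
wall-normal derivatives of `H` and `H′` agree at every such wall point: `(d∕ds)|₀ H(tA′+sN′) = (d∕ds)|₀ H′(tA′+sN′)` — premise (h1) of ★ `lambda8Angle_zero_eq_of_wall02_oddJets_of_isOpen`.
Both equal `r(0)·L`, `r(0) = 2i(1 − cos 3t)`, by §3 on each side: the EVEN cofactor of §2 kills the jump of `F_Θ` itself. [cite: Rogawski1990, §8.2 p. 119] [cite: Rogawski1990, §8.4 p. 126]
[cite: Varadarajan1989, §6.4 Thm 22] -/
theorem deriv_cornerExtensions_eq_of_wall02_limitFormula (Fz : (Fin 3 → Circle) → ℂ) (ζ : Circle)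
    {U : Set (Fin 3 → ℝ)} (hU : IsOpen U) {H H' : (Fin 3 → ℝ) → ℂ} (hH : ContDiffOn ℝ 1 H U) (hH' : ContDiffOn ℝ 1 H' U)
    {S : Set ℝ} (hSU : ∀ t ∈ S, t • (![1, -2, 1] : Fin 3 → ℝ) ∈ U) (hSreg : ∀ t ∈ S, Real.cos (3 * t) ≠ 1)
    (hHF : ∀ t ∈ S, ∀ᶠ s in 𝓝[>] (0 : ℝ), H (t • (![1, -2, 1] : Fin 3 → ℝ) + s • (![1, 0, -1] : Fin 3 → ℝ)) =
      ((((ζ * Circle.exp ((t • (![1, -2, 1] : Fin 3 → ℝ) + s • (![1, 0, -1] : Fin 3 → ℝ)) 0) : Circle) : ℂ)) *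
          (((ζ * Circle.exp ((t • (![1, -2, 1] : Fin 3 → ℝ) + s • (![1, 0, -1] : Fin 3 → ℝ)) 2) : Circle) : ℂ))⁻¹) *
        ((1 - (((ζ * Circle.exp ((t • (![1, -2, 1] : Fin 3 → ℝ) + s • (![1, 0, -1] : Fin 3 → ℝ)) 1) : Circle) : ℂ)) *
              (((ζ * Circle.exp ((t • (![1, -2, 1] : Fin 3 → ℝ) + s • (![1, 0, -1] : Fin 3 → ℝ)) 0) : Circle) : ℂ))⁻¹) *
          (1 - (((ζ * Circle.exp ((t • (![1, -2, 1] : Fin 3 → ℝ) + s • (![1, 0, -1] : Fin 3 → ℝ)) 2) : Circle) : ℂ)) *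
              (((ζ * Circle.exp ((t • (![1, -2, 1] : Fin 3 → ℝ) + s • (![1, 0, -1] : Fin 3 → ℝ)) 1) : Circle) : ℂ))⁻¹) *
          (1 - (((ζ * Circle.exp ((t • (![1, -2, 1] : Fin 3 → ℝ) + s • (![1, 0, -1] : Fin 3 → ℝ)) 2) : Circle) : ℂ)) *
              (((ζ * Circle.exp ((t • (![1, -2, 1] : Fin 3 → ℝ) + s • (![1, 0, -1] : Fin 3 → ℝ)) 0) : Circle) : ℂ))⁻¹)) *
        Fz (fun k : Fin 3 => ζ * Circle.exp ((t • (![1, -2, 1] : Fin 3 → ℝ) + s • (![1, 0, -1] : Fin 3 → ℝ)) k)))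
    (hH'F : ∀ t ∈ S, ∀ᶠ s in 𝓝[<] (0 : ℝ), H' (t • (![1, -2, 1] : Fin 3 → ℝ) + s • (![1, 0, -1] : Fin 3 → ℝ)) =
      ((((ζ * Circle.exp ((t • (![1, -2, 1] : Fin 3 → ℝ) + s • (![1, 0, -1] : Fin 3 → ℝ)) 0) : Circle) : ℂ)) *
          (((ζ * Circle.exp ((t • (![1, -2, 1] : Fin 3 → ℝ) + s • (![1, 0, -1] : Fin 3 → ℝ)) 2) : Circle) : ℂ))⁻¹) *
        ((1 - (((ζ * Circle.exp ((t • (![1, -2, 1] : Fin 3 → ℝ) + s • (![1, 0, -1] : Fin 3 → ℝ)) 1) : Circle) : ℂ)) *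
              (((ζ * Circle.exp ((t • (![1, -2, 1] : Fin 3 → ℝ) + s • (![1, 0, -1] : Fin 3 → ℝ)) 0) : Circle) : ℂ))⁻¹) *
          (1 - (((ζ * Circle.exp ((t • (![1, -2, 1] : Fin 3 → ℝ) + s • (![1, 0, -1] : Fin 3 → ℝ)) 2) : Circle) : ℂ)) *
              (((ζ * Circle.exp ((t • (![1, -2, 1] : Fin 3 → ℝ) + s • (![1, 0, -1] : Fin 3 → ℝ)) 1) : Circle) : ℂ))⁻¹) *
          (1 - (((ζ * Circle.exp ((t • (![1, -2, 1] : Fin 3 → ℝ) + s • (![1, 0, -1] : Fin 3 → ℝ)) 2) : Circle) : ℂ)) *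
              (((ζ * Circle.exp ((t • (![1, -2, 1] : Fin 3 → ℝ) + s • (![1, 0, -1] : Fin 3 → ℝ)) 0) : Circle) : ℂ))⁻¹)) *
        Fz (fun k : Fin 3 => ζ * Circle.exp ((t • (![1, -2, 1] : Fin 3 → ℝ) + s • (![1, 0, -1] : Fin 3 → ℝ)) k)))
    (hJ : ∀ t ∈ S, ∃ L : ℂ, Tendsto (fun ψ : ℝ => deriv (fun ψ : ℝ => (2 * Real.sin ψ : ℂ) *
        Fz (fun i : Fin 3 => ζ * Circle.exp ((t • (![1, -2, 1] : Fin 3 → ℝ)) i) * Circle.exp ((![(1 : ℝ), 0, -1] : Fin 3 → ℝ) i * ψ))) ψ)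
        (𝓝[≠] 0) (𝓝 L)) :
    ∀ t ∈ S, deriv (fun s : ℝ => H (t • (![1, -2, 1] : Fin 3 → ℝ) + s • (![1, 0, -1] : Fin 3 → ℝ))) 0 =
      deriv (fun s : ℝ => H' (t • (![1, -2, 1] : Fin 3 → ℝ) + s • (![1, 0, -1] : Fin 3 → ℝ))) 0 := by
  intro t ht
  obtain ⟨L, hL⟩ := hJ t ht
  -- the even cofactor `r(s) = i(2cos s − 2cos 3t)` and its derivative
  have hr : ∀ s : ℝ, HasDerivAt (fun s : ℝ => Complex.I * (2 * Real.cos s - 2 * Real.cos (3 * t) : ℂ))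
      (Complex.I * (2 * ((-Real.sin s : ℝ) : ℂ))) s := by
    intro s
    have h := (((Real.hasDerivAt_cos s).ofReal_comp).const_mul (2 : ℂ)).sub_const (2 * Real.cos (3 * t) : ℂ)
    exact h.const_mul Complex.I
  have hr'0 : Tendsto (fun s : ℝ => Complex.I * (2 * ((-Real.sin s : ℝ) : ℂ))) (𝓝 0) (𝓝 0) := by
    have hc : Continuous fun s : ℝ => Complex.I * (2 * ((-Real.sin s : ℝ) : ℂ)) := by fun_prop
    simpa only [Real.sin_zero, neg_zero, Complex.ofReal_zero, mul_zero] using hc.tendsto 0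
  have hr0 : (fun s : ℝ => Complex.I * (2 * Real.cos s - 2 * Real.cos (3 * t) : ℂ)) 0 ≠ 0 := by
    have hreal : (2 * Real.cos (0 : ℝ) - 2 * Real.cos (3 * t) : ℝ) ≠ 0 := by
      rw [Real.cos_zero]
      intro h
      exact hSreg t ht (by linarith)
    refine mul_ne_zero Complex.I_ne_zero ?_
    exact_mod_cast hreal
  -- the normal lines through `tA′` stay in `U` near `s = 0`
  have hVo : IsOpen {s : ℝ | t • (![1, -2, 1] : Fin 3 → ℝ) + s • (![1, 0, -1] : Fin 3 → ℝ) ∈ U} :=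
    hU.preimage (by fun_prop)
  have hV0 : (0 : ℝ) ∈ {s : ℝ | t • (![1, -2, 1] : Fin 3 → ℝ) + s • (![1, 0, -1] : Fin 3 → ℝ) ∈ U} := by
    simpa only [Set.mem_setOf_eq, zero_smul, add_zero] using hSU t ht
  have hline : ContDiff ℝ 1 (fun s : ℝ => t • (![1, -2, 1] : Fin 3 → ℝ) + s • (![1, 0, -1] : Fin 3 → ℝ)) := by fun_prop
  have hh : ContDiffOn ℝ 1 (fun s : ℝ => H (t • (![1, -2, 1] : Fin 3 → ℝ) + s • (![1, 0, -1] : Fin 3 → ℝ)))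
      {s : ℝ | t • (![1, -2, 1] : Fin 3 → ℝ) + s • (![1, 0, -1] : Fin 3 → ℝ) ∈ U} := hH.comp hline.contDiffOn fun s hs => hs
  have hh' : ContDiffOn ℝ 1 (fun s : ℝ => H' (t • (![1, -2, 1] : Fin 3 → ℝ) + s • (![1, 0, -1] : Fin 3 → ℝ)))
      {s : ℝ | t • (![1, -2, 1] : Fin 3 → ℝ) + s • (![1, 0, -1] : Fin 3 → ℝ) ∈ U} := hH'.comp hline.contDiffOn fun s hs => hs
  -- on each side, `H∘line = r · g` with `g` the (J-nc) function
  have hfac : ∀ s : ℝ,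
      ((((ζ * Circle.exp ((t • (![1, -2, 1] : Fin 3 → ℝ) + s • (![1, 0, -1] : Fin 3 → ℝ)) 0) : Circle) : ℂ)) *
          (((ζ * Circle.exp ((t • (![1, -2, 1] : Fin 3 → ℝ) + s • (![1, 0, -1] : Fin 3 → ℝ)) 2) : Circle) : ℂ))⁻¹) *
        ((1 - (((ζ * Circle.exp ((t • (![1, -2, 1] : Fin 3 → ℝ) + s • (![1, 0, -1] : Fin 3 → ℝ)) 1) : Circle) : ℂ)) *
              (((ζ * Circle.exp ((t • (![1, -2, 1] : Fin 3 → ℝ) + s • (![1, 0, -1] : Fin 3 → ℝ)) 0) : Circle) : ℂ))⁻¹) *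
          (1 - (((ζ * Circle.exp ((t • (![1, -2, 1] : Fin 3 → ℝ) + s • (![1, 0, -1] : Fin 3 → ℝ)) 2) : Circle) : ℂ)) *
              (((ζ * Circle.exp ((t • (![1, -2, 1] : Fin 3 → ℝ) + s • (![1, 0, -1] : Fin 3 → ℝ)) 1) : Circle) : ℂ))⁻¹) *
          (1 - (((ζ * Circle.exp ((t • (![1, -2, 1] : Fin 3 → ℝ) + s • (![1, 0, -1] : Fin 3 → ℝ)) 2) : Circle) : ℂ)) *
              (((ζ * Circle.exp ((t • (![1, -2, 1] : Fin 3 → ℝ) + s • (![1, 0, -1] : Fin 3 → ℝ)) 0) : Circle) : ℂ))⁻¹)) *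
        Fz (fun k : Fin 3 => ζ * Circle.exp ((t • (![1, -2, 1] : Fin 3 → ℝ) + s • (![1, 0, -1] : Fin 3 → ℝ)) k)) =
      (fun s : ℝ => Complex.I * (2 * Real.cos s - 2 * Real.cos (3 * t) : ℂ)) s *
        (fun ψ : ℝ => (2 * Real.sin ψ : ℂ) *
          Fz (fun i : Fin 3 => ζ * Circle.exp ((t • (![1, -2, 1] : Fin 3 → ℝ)) i) * Circle.exp ((![(1 : ℝ), 0, -1] : Fin 3 → ℝ) i * ψ))) s := by
    intro s
    rw [rhoWeylDelta_angleChart_wall02_line ζ t s, angleChart_wall02_line_eq_curve ζ t s]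
    ring
  have hsubp : 𝓝[>] (0 : ℝ) ≤ 𝓝[≠] 0 := nhdsWithin_mono 0 fun x hx => Set.mem_compl_singleton_iff.2 (ne_of_gt hx)
  have hsubm : 𝓝[<] (0 : ℝ) ≤ 𝓝[≠] 0 := nhdsWithin_mono 0 fun x hx => Set.mem_compl_singleton_iff.2 (ne_of_lt hx)
  have ep := deriv_eq_mul_of_eventuallyEq_mul_of_tendsto_deriv isOpen_Ioi hVo hV0 hh hr hr'0 hr0
    ((hHF t ht).mono fun s hs => by rw [hs]; exact hfac s) (hL.mono_left hsubp)
  have em := deriv_eq_mul_of_eventuallyEq_mul_of_tendsto_deriv isOpen_Iio hVo hV0 hh' hr hr'0 hr0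
    ((hH'F t ht).mono fun s hs => by rw [hs]; exact hfac s) (hL.mono_left hsubm)
  rw [ep, em]

end FirstJet

end Literature.NumberTheory.Rogawski1990

end
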